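import Mathlib
import Summits.Ventures.DiscreteObjects.Mahler.LowDegreeCensus

/-!
# Census rows in every odd degree (venture `DiscreteObjects`, target L)

Cell `pub-namedobj`, seat `pub-namedobj-mahler` (gen 10). Framing: lottery ticket; floor = certified
bounds/negative ranges.

An irreducible integer polynomial of odd degree `≥ 3` is neither reciprocal nor antireciprocal (a
palindromic polynomial of odd degree vanishes at `-1`, an antipalindromic one at `1`), so Smyth's theorem
([McKee–Smyth, Thm 12.1], kernel gen 8/9) applies to it: `M ≥ θ₀ = 1.3247…`, with `M < 1.3248` only for
the eight trinomials `±(1 - X^{2k} ± X^{3k})`, `±(1 ∓ X^k ± X^{3k})` of degree `3k`.  In the census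
vocabulary of the cell this settles EVERY ODD-DEGREE ROW below `1.3248` with zero compute — the reason why
the tables of small Mahler measures (Boyd, Mossinghoff, Mossinghoff–Rhin–Wu) list even degrees only:

* `nonreciprocal_of_irreducible_odd` — odd degree `≥ 3`, irreducible ⇒ `P(0) ≠ 0`, `P.reverse ≠ ±P`;
* `smythTheta_le_of_irreducible_odd` — `θ₀ ≤ M(P)`;
* `degreeCensus_odd_smythTheta` — `DegreeCensus n B []` for every odd `n` and `B ≤ θ₀`;
* `eq_smyth_trinomial_of_irreducible_odd` — odd degree, `M(P) < 1.3248` ⇒ `3 ∣ deg P` and `P` is one of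
  the eight Smyth trinomials;
* `degreeCensus_odd_of_not_three_dvd` — `DegreeCensus n 1.3248 []` for every odd `n` with `3 ∤ n`.
-/

namespace Summit.Ventures.DiscreteObjects.Mahler

open Polynomial

/-- An irreducible integer polynomial of odd degree `≥ 3` has `P(0) ≠ 0` and is neither reciprocal nor
antireciprocal. -/
theorem nonreciprocal_of_irreducible_odd {P : ℤ[X]} (hirr : Irreducible P) (hodd : Odd P.natDegree)
    (h3 : 3 ≤ P.natDegree) : P.coeff 0 ≠ 0 ∧ P.reverse ≠ P ∧ P.reverse ≠ -P := by
  have key : ∀ t : ℤ, P.eval t ≠ 0 := by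
    intro t ht
    have hdvd : X - C t ∣ P := dvd_iff_isRoot.mpr ht
    have hass : Associated (X - C t) P := (irreducible_X_sub_C t).associated_of_dvd hirr hdvd
    have h1 := natDegree_eq_of_degree_eq (degree_eq_degree_of_associated hass)
    rw [natDegree_X_sub_C] at h1
    omega
  refine ⟨?_, fun h => key (-1) (eval_neg_one_eq_zero_of_reverse_eq h hodd),
    fun h => key 1 (eval_one_eq_zero_of_reverse_eq_neg h)⟩
  rw [coeff_zero_eq_eval_zero]
  exact key 0

/-- **Smyth's bound in odd degree:** an irreducible integer polynomial of odd degree `≥ 3` has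
`M(P) ≥ θ₀ = 1.3247…`. -/
theorem smythTheta_le_of_irreducible_odd {P : ℤ[X]} (hirr : Irreducible P) (hodd : Odd P.natDegree)
    (h3 : 3 ≤ P.natDegree) : smythTheta ≤ intMahlerMeasure P := by
  obtain ⟨h0, h1, h2⟩ := nonreciprocal_of_irreducible_odd hirr hodd h3
  exact intMahlerMeasure_ge_smythTheta_of_nonreciprocal h0 h1 h2

/-- **Odd-degree census rows below `θ₀`:** `DegreeCensus n B []` for every odd `n` and every `B ≤ θ₀`. -/
theorem degreeCensus_odd_smythTheta {n : ℕ} (hn : Odd n) {B : ℝ} (hB : B ≤ smythTheta) :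
    DegreeCensus n B [] := by
  rcases Nat.lt_or_ge n 3 with hlt | hge
  · -- `n = 1`
    have hn1 : n = 1 := by obtain ⟨k, hk⟩ := hn; omega
    subst hn1
    exact degreeCensus_one (by linarith [smythTheta_lt])
  · intro p hdeg hirr h1 h2
    exfalso
    have := smythTheta_le_of_irreducible_odd hirr (hdeg ▸ hn) (hdeg ▸ hge)
    linarith

/-- **Odd degree below `1.3248`:** an irreducible `P ∈ ℤ[X]` of odd degree `n ≥ 3` with `M(P) < 1.3248`
has `n = 3k` and is one of the eight Smyth trinomials `±(1 - X^{2k} + aX^{3k})`, `±(1 - aX^k + aX^{3k})`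
(`a = ±1`), all of measure `θ₀`. -/
theorem eq_smyth_trinomial_of_irreducible_odd {P : ℤ[X]} (hirr : Irreducible P) (hodd : Odd P.natDegree)
    (h3 : 3 ≤ P.natDegree) (hlt : intMahlerMeasure P < 13248 / 10000) :
    intMahlerMeasure P = smythTheta ∧ ∃ k : ℕ, P.natDegree = 3 * k ∧ ∃ a : ℤ, (a = 1 ∨ a = -1) ∧
      ∃ s : ℤ, (s = 1 ∨ s = -1) ∧
        (P = C s * (1 - X ^ (2 * k) + C a * X ^ (3 * k)) ∨ P = C s * (1 - C a * X ^ k + C a * X ^ (3 * k))) := by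
  obtain ⟨h0, h1, h2⟩ := nonreciprocal_of_irreducible_odd hirr hodd h3
  have hMθ : intMahlerMeasure P = smythTheta := intMahlerMeasure_eq_smythTheta_of_lt hirr h0 h1 h2 hlt
  obtain ⟨k, hk, a, ha, s, hs, hform⟩ := (intMahlerMeasure_eq_smythTheta_iff_eq hirr h0 h1 h2).mp hMθ
  have ha0 : a ≠ 0 := by rcases ha with h | h <;> simp [h]
  have hs0 : s ≠ 0 := by rcases hs with h | h <;> simp [h]
  have hdegP : (1 - X ^ (2 * k) + C a * X ^ (3 * k) : ℤ[X]).natDegree = 3 * k := by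
    have : (1 - X ^ (2 * k) + C a * X ^ (3 * k) : ℤ[X]) = trinomial 0 (2 * k) (3 * k) 1 (-1) a := by
      rw [trinomial_def]; simp; ring
    rw [this]; exact trinomial_natDegree (by omega) (by omega) ha0
  have hdegQ : (1 - C a * X ^ k + C a * X ^ (3 * k) : ℤ[X]).natDegree = 3 * k := by
    have : (1 - C a * X ^ k + C a * X ^ (3 * k) : ℤ[X]) = trinomial 0 k (3 * k) 1 (-a) a := by
      rw [trinomial_def]; simp; ring
    rw [this]; exact trinomial_natDegree (by omega) (by omega) ha0
  have hdeg : P.natDegree = 3 * k := by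
    rcases hform with h | h
    · rw [h, natDegree_C_mul hs0, hdegP]
    · rw [h, natDegree_C_mul hs0, hdegQ]
  exact ⟨hMθ, k, hdeg, a, ha, s, hs, hform⟩

/-- **Odd-degree census rows below `1.3248`, `3 ∤ n`:** `DegreeCensus n 1.3248 []` for every odd `n`
not divisible by `3` — no irreducible integer polynomial of such a degree has Mahler measure in
`(1, 1.3248)`. -/
theorem degreeCensus_odd_of_not_three_dvd {n : ℕ} (hn : Odd n) (h3 : ¬ 3 ∣ n) :
    DegreeCensus n (13248 / 10000) [] := by
  rcases Nat.lt_or_ge n 3 with hlt | hge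
  · have hn1 : n = 1 := by obtain ⟨k, hk⟩ := hn; omega
    subst hn1
    exact degreeCensus_one (by norm_num)
  · intro p hdeg hirr h1 h2
    exfalso
    obtain ⟨-, k, hk, -⟩ := eq_smyth_trinomial_of_irreducible_odd hirr (hdeg ▸ hn) (hdeg ▸ hge) h2
    exact h3 ⟨k, by rw [← hdeg, hk]⟩

end Summit.Ventures.DiscreteObjects.Mahler
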